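import Summits.ResolutionOfSingularities.ResolutionOfSingularities.Theorems.WeightedInvariantIotaOrderNotCanonical
import Summits.ResolutionOfSingularities.ResolutionOfSingularities.Theorems.WeightedInvariantIotaLex
import HarnessLib

/-!
# What EVERY witness `(ι, J)` of the canonical game clause must do at `z² + x³y³`: separate the origin STRICTLY from
# both branches of the max-`ord` locus — door `HypersurfaceCentreConstruction` (stmt-ResolutionOfSingularities-19897),
# route `WeightedInvariant`; clause (c9′)(strat)+(adm) of `…HypersurfaceLocalGameEFT3` / `…EFT4S`

[OURS · L1 W4.3 · cell `res-hironaka`, HUMAN RULING D-0089] Helper file `--supports stmt-ResolutionOfSingularities-19897`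
— a CALIBRATION TEST for candidate invariants, sequel to `…IotaOrderNotCanonical` (p506015: the order function alone
fails (strat)) and `…IotaLex` (p504861: lexicographic refinements).  No statement of the manuscript under review
(Hironaka 2017) is typed or used, nothing is attributed to its author, nothing here is a claim about resolution of
singularities.  AI-produced, weaker than expert review.  Typer res-type-073 (reserve volunteer on res-L1-w43-plan-1's
(o·) desk terms).  PRIORITY OF THE REMARK: res-L1-w43-tri-2 TRIAGE v4 (D4), 2026-08-27T05:48:34Z: «(c6) + the symmetry
x ↔ y force the origin STRICTLY above both branches ⇒ the witness ι must refine ord by an invariant of the embedded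
top locus».  This file is that sentence in the kernel, for EVERY `(ι, J)` — not only for `ι = ord`.

## Statements (specimen `S = k[x,y,z]_{(x,y,z)}`, `f = z² + x³y³`, branch primes `QS₁ = (z,x)S`, `QS₂ = (z,y)S`; `k` any
perfect field of characteristic `p`, as the clause demands)

* `witness_separates_origin`: `CanonicalGameClause p ι J` alone ⇒ `ι(S_{QS₁}) f ≠ ι(S) f ∨ ι(S_{QS₂}) f ≠ ι(S) f`.
  Proof: otherwise (strat) puts the centre prime `P` below both branches and (adm) at `Q = P` gives `f/1 ∈ 𝔪_{S_P}²`,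
  which `…IotaOrderNotCanonical` refutes by first-order Hasse derivatives (`algebraMap_fS_not_mem_sq_of_le`).  The
  regularity of `S ⧸ P` is not used.
* `iota_QS₁_eq_iota_QS₂`: for (c6) iso-invariant `ι` the two branch values agree — the swap `x ↔ y` fixes `f` and the
  origin and exchanges the branches; it induces `S ≃+* S` and `S_{QS₁} ≃+* S_{QS₂}` (`IsLocalization.ringEquivOfRingEquiv`,
  twice).
* `witness_strictly_separates_origin`: with (c6) and (c7), `ι(S_{QSᵢ}) f < ι(S) f` for BOTH `i` — while the order is
  `2` at all three points (`iotaOrd_fS`, `iotaOrd_QS₁`, `iotaOrd_QS₂`).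
* `secondKey_strictly_separates_origin`: for a lexicographic refinement `iotaLex Λ iotaOrd ι₂` of the order (second key
  bounded by `Λ`) it is the SECOND key that strictly drops from the origin to each branch point (`iotaLex_lt_iff`).

## References

* res-L1-w43-tri-2, `L/res-L1-w43-tri-2/TRIAGE.md` §v4 (D4); res-L1-w43-plan-1 CRUX-PLAN Addenda 13–14 (OURS, AI).
* H. Matsumura, *Commutative Ring Theory*, §4 (localisation of localisations; extension/contraction). [cite: Matsumura1987, §4]
-/

set_option linter.dupNamespace false -- mandated namespace `Summit.<Summit>.<Problem>` of this single-conjunct summit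

noncomputable section

namespace Summit.ResolutionOfSingularities.ResolutionOfSingularities.Cruxes.HypersurfaceCentreConstruction.LocalEngine

open IsLocalRing MvPolynomial Finsupp
open Literature.AlgebraicGeometry.Resolution
open Summit.ResolutionOfSingularities.ResolutionOfSingularities.Theorems

namespace StratSpecimen

variable (k : Type) [Field k]

/-! ## `f/1 ∉ 𝔪_{S_P}²` below both branches, read without `ι` -/

/-- For a prime `P ∋ f` of `S` below both branch primes, `f/1 ∉ 𝔪_{S_P}²` (the `ι`-free content of
`not_two_le_iotaOrd_of_le`). -/
theorem algebraMap_fS_not_mem_sq_of_le (P : Ideal (OriginLocalization k 3)) [P.IsPrime] (hfP : fS k ∈ P)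
    (h₁ : P ≤ QS₁ k) (h₂ : P ≤ QS₂ k) :
    algebraMap (OriginLocalization k 3) (Localization.AtPrime P) (fS k) ∉
      maximalIdeal (Localization.AtPrime P) ^ 2 := fun h =>
  not_two_le_iotaOrd_of_le k P hfP h₁ h₂
    (by exact_mod_cast (natCast_le_iotaOrd_iff (Localization.AtPrime P) _ 2).2 h)

/-! ## Every `(ι, J)` satisfying the canonical game clause separates the origin from a branch -/

/-- **Calibration test for EVERY candidate `(ι, J)`** (any perfect field `k` of characteristic `p`): if
`CanonicalGameClause p ι J` holds then at the position `(k[x,y,z]_{(x,y,z)}, z² + x³y³)` the value of `ι` at the origin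
differs from its value at the generic point of at least one of the two branches `(z,x)`, `(z,y)` of the max-`ord`
locus.  Proof: otherwise (strat) puts the centre prime `P` below both branches, and (adm) at `Q = P` gives
`f/1 ∈ 𝔪_{S_P}²`, refuted by `algebraMap_fS_not_mem_sq_of_le`.  (No use of the regularity of `S ⧸ P`.) [OURS · L1 W4.3] -/
theorem witness_separates_origin {p : ℕ} [CharP k p] [PerfectField k]
    (ι : (R : Type) → [CommRing R] → R → Ordinal.{0}) (J : (R : Type) → [CommRing R] → R → ℕ → Ideal R)
    (hgame : CanonicalGameClause p ι J) :
    ι (Localization.AtPrime (QS₁ k)) (algebraMap (OriginLocalization k 3) (Localization.AtPrime (QS₁ k)) (fS k)) ≠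
        ι (OriginLocalization k 3) (fS k) ∨
      ι (Localization.AtPrime (QS₂ k)) (algebraMap (OriginLocalization k 3) (Localization.AtPrime (QS₂ k)) (fS k)) ≠
        ι (OriginLocalization k 3) (fS k) := by
  haveI : Algebra.EssFiniteType k (OriginLocalization k 3) :=
    Algebra.EssFiniteType.comp k (MvPolynomial (Fin 3) k) (OriginLocalization k 3)
  by_contra hboth
  push Not at hboth
  obtain ⟨h1, h2⟩ := hboth
  obtain ⟨P, hP, -, hfP, hstrat, -, n, u, w, -, -, -, -, -, hadm, -⟩ :=
    hgame k (OriginLocalization k 3) (fS k) (fS_ne_zero k) (fS_mem_sq k)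
  haveI := hP
  have hP₁ : P ≤ QS₁ k := (hstrat (QS₁ k) (fS_mem_QS₁ k)).1 h1
  have hP₂ : P ≤ QS₂ k := (hstrat (QS₂ k) (fS_mem_QS₂ k)).1 h2
  exact algebraMap_fS_not_mem_sq_of_le k P hfP hP₁ hP₂ (hadm P le_rfl)

/-! ## The symmetry `x ↔ y`: the two branch values of an iso-invariant `ι` agree -/

/-- [OURS] The swap `x₀ ↔ x₁` of `k[x₀,x₁,x₂]`. -/
def swapA : MvPolynomial (Fin 3) k ≃+* MvPolynomial (Fin 3) k :=
  (renameEquiv k (Equiv.swap (0 : Fin 3) 1)).toRingEquiv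

/-- The swap fixes `F`. -/
theorem swapA_F : swapA k (F k) = F k := by
  change rename (Equiv.swap (0 : Fin 3) 1) (F k) = F k
  simp only [F, map_add, map_pow, map_mul, rename_X, Equiv.swap_apply_left, Equiv.swap_apply_right,
    Equiv.swap_apply_of_ne_of_ne (show (2 : Fin 3) ≠ 0 by decide) (show (2 : Fin 3) ≠ 1 by decide)]
  ring

/-- The swap preserves the ideal of the origin. -/
theorem comap_swapA_originIdeal : (originIdeal k 3).comap (swapA k).toRingHom = originIdeal k 3 := by
  ext g
  rw [Ideal.mem_comap, mem_originIdeal_iff, mem_originIdeal_iff]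
  change constantCoeff (rename _ g) = 0 ↔ _
  rw [constantCoeff_rename]

/-- The swap carries `Q₁` to `Q₂`: `Q₁ = Q₂ ∘ swap`. -/
theorem comap_swapA_Q₂ : (Q₂ k).comap (swapA k).toRingHom = Q₁ k := by
  have hcomp : (branchHom₂ k).comp (renameEquiv k (Equiv.swap (0 : Fin 3) 1)).toAlgHom = branchHom₁ k := by
    apply MvPolynomial.algHom_ext; intro i
    fin_cases i <;> simp [branchHom₁, branchHom₂, Equiv.swap_apply_of_ne_of_ne]
  ext g
  rw [Ideal.mem_comap]
  change (branchHom₂ k).toRingHom (renameEquiv k _ g) = 0 ↔ (branchHom₁ k).toRingHom g = 0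
  rw [← hcomp]
  rfl

/-- Images of prime complements under a ring isomorphism matching two primes. [folklore] -/
theorem map_primeCompl_eq_of_comap_eq {R R' : Type*} [CommRing R] [CommRing R'] (e : R ≃+* R') (I : Ideal R)
    (I' : Ideal R') [I.IsPrime] [I'.IsPrime] (h : I'.comap e.toRingHom = I) :
    I.primeCompl.map e.toMonoidHom = I'.primeCompl := by
  ext x
  constructor
  · rintro ⟨y, hy, rfl⟩ hx
    exact hy (by rw [← h]; exact hx)
  · intro hx
    refine ⟨e.symm x, fun hy => hx ?_, by simp⟩
    rw [← h] at hy
    have hy' : e (e.symm x) ∈ I' := hy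
    simpa using hy'

/-- [OURS] The swap on `S = k[x,y,z]_{(x,y,z)}`. -/
def swapS : OriginLocalization k 3 ≃+* OriginLocalization k 3 :=
  IsLocalization.ringEquivOfRingEquiv (M := (originIdeal k 3).primeCompl) (T := (originIdeal k 3).primeCompl)
    (OriginLocalization k 3) (OriginLocalization k 3) (swapA k)
    (map_primeCompl_eq_of_comap_eq (swapA k) _ _ (comap_swapA_originIdeal k))

/-- `swapS ∘ (A → S) = (A → S) ∘ swapA`. -/
theorem swapS_algebraMap (g : MvPolynomial (Fin 3) k) :
    swapS k (algebraMap _ (OriginLocalization k 3) g) = algebraMap _ (OriginLocalization k 3) (swapA k g) := by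
  rw [swapS, IsLocalization.ringEquivOfRingEquiv_eq]

/-- The swap fixes `f`. -/
theorem swapS_fS : swapS k (fS k) = fS k := by
  rw [fS, swapS_algebraMap, swapA_F]

/-- The swap carries `QS₁` to `QS₂`. -/
theorem comap_swapS_QS₂ : (QS₂ k).comap (swapS k).toRingHom = QS₁ k := by
  have hA : ((QS₂ k).comap (swapS k).toRingHom).under (MvPolynomial (Fin 3) k) = Q₁ k := by
    rw [Ideal.under_def, ← comap_swapA_Q₂ k, ← comap_QS₂ k]
    ext g
    simp only [Ideal.mem_comap, RingEquiv.toRingHom_eq_coe, RingHom.coe_coe]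
    rw [swapS_algebraMap]
  rw [← IsLocalization.map_under (originIdeal k 3).primeCompl (OriginLocalization k 3)
    ((QS₂ k).comap (swapS k).toRingHom), hA]
  rfl

/-- [OURS] The induced isomorphism of the two branch local rings `S_{QS₁} ≃ S_{QS₂}`. -/
def swapBranch : Localization.AtPrime (QS₁ k) ≃+* Localization.AtPrime (QS₂ k) :=
  IsLocalization.ringEquivOfRingEquiv (M := (QS₁ k).primeCompl) (T := (QS₂ k).primeCompl)
    (Localization.AtPrime (QS₁ k)) (Localization.AtPrime (QS₂ k)) (swapS k)
    (map_primeCompl_eq_of_comap_eq (swapS k) _ _ (comap_swapS_QS₂ k))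

/-- The branch isomorphism fixes the image of `f`. -/
theorem swapBranch_fS :
    swapBranch k (algebraMap (OriginLocalization k 3) (Localization.AtPrime (QS₁ k)) (fS k)) =
      algebraMap (OriginLocalization k 3) (Localization.AtPrime (QS₂ k)) (fS k) := by
  rw [swapBranch, IsLocalization.ringEquivOfRingEquiv_eq, swapS_fS]

/-- For an iso-invariant `ι` the two branch values agree. -/
theorem iota_QS₁_eq_iota_QS₂ (ι : (R : Type) → [CommRing R] → R → Ordinal.{0}) (hc6 : IotaIsoInvariant ι) :
    ι (Localization.AtPrime (QS₁ k)) (algebraMap (OriginLocalization k 3) (Localization.AtPrime (QS₁ k)) (fS k)) =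
      ι (Localization.AtPrime (QS₂ k)) (algebraMap (OriginLocalization k 3) (Localization.AtPrime (QS₂ k)) (fS k)) := by
  rw [← swapBranch_fS]
  exact (hc6 (Localization.AtPrime (QS₁ k)) (Localization.AtPrime (QS₂ k)) (swapBranch k)
    (algebraMap (OriginLocalization k 3) (Localization.AtPrime (QS₁ k)) (fS k))).symm

/-- **What every EFT3/EFT4S witness must do at `z² + x³y³`**: with (c6) iso-invariance and (c7) generization
monotonicity, `ι` is STRICTLY larger at the origin than at the generic points of BOTH branches of the max-`ord` locus
(where the order itself is constant `= 2`).  This is res-L1-w43-tri-2's (D4) «(c6) + the symmetry `x ↔ y` force the origin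
STRICTLY above both branches» in the kernel — the calibration test a refined `ι` must pass. [OURS · L1 W4.3] -/
theorem witness_strictly_separates_origin {p : ℕ} [CharP k p] [PerfectField k]
    (ι : (R : Type) → [CommRing R] → R → Ordinal.{0}) (J : (R : Type) → [CommRing R] → R → ℕ → Ideal R)
    (hc6 : IotaIsoInvariant ι) (hc7 : IotaGenerizationMonotone ι) (hgame : CanonicalGameClause p ι J) :
    ι (Localization.AtPrime (QS₁ k)) (algebraMap (OriginLocalization k 3) (Localization.AtPrime (QS₁ k)) (fS k)) <
        ι (OriginLocalization k 3) (fS k) ∧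
      ι (Localization.AtPrime (QS₂ k)) (algebraMap (OriginLocalization k 3) (Localization.AtPrime (QS₂ k)) (fS k)) <
        ι (OriginLocalization k 3) (fS k) := by
  have hsym := iota_QS₁_eq_iota_QS₂ k ι hc6
  have hle₁ := hc7 (OriginLocalization k 3) (QS₁ k) (fS k)
  have hle₂ := hc7 (OriginLocalization k 3) (QS₂ k) (fS k)
  rcases witness_separates_origin k ι J hgame with h | h
  · exact ⟨lt_of_le_of_ne hle₁ h, lt_of_le_of_ne hle₂ (hsym ▸ h)⟩
  · exact ⟨lt_of_le_of_ne hle₁ (hsym.symm ▸ h), lt_of_le_of_ne hle₂ h⟩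


/-- The same for the conjunct list of the REGISTERED key H2a⁗ `LocalWeightedDropEFT4S p` (any given `ι`, `J`): every
witness strictly separates the origin of `z² + x³y³` from both branch points. [OURS · L1 W4.3] -/
theorem eft4S_conjuncts_strictly_separate_origin {p : ℕ} [CharP k p] [PerfectField k]
    (ι : (R : Type) → [CommRing R] → R → Ordinal.{0}) (J : (R : Type) → [CommRing R] → R → ℕ → Ideal R)
    (h : IotaIsoInvariant ι ∧ IotaGenerizationMonotone ι ∧ IotaUpperSemicontinuous ι ∧ IotaTorusFactorMonotone ι ∧
      JIsoInvariant J ∧ IotaJEssSmoothCompatible ι J ∧ CanonicalGameClause p ι J ∧ JOpenPresentationForallSing p ι J ∧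
      IotaUnitInvariant ι ∧ JUnitInvariant J) :
    ι (Localization.AtPrime (QS₁ k)) (algebraMap (OriginLocalization k 3) (Localization.AtPrime (QS₁ k)) (fS k)) <
        ι (OriginLocalization k 3) (fS k) ∧
      ι (Localization.AtPrime (QS₂ k)) (algebraMap (OriginLocalization k 3) (Localization.AtPrime (QS₂ k)) (fS k)) <
        ι (OriginLocalization k 3) (fS k) :=
  witness_strictly_separates_origin k ι J h.1 h.2.1 h.2.2.2.2.2.2.1

/-- **Reading for lexicographic refinements of the order** (`iotaLex Λ iotaOrd ι₂`, tree combinator p504861): since the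
order is `2` at the origin and at both branch points, it is the SECOND key that must strictly drop from the origin to
the generic point of each branch. [OURS · L1 W4.3] -/
theorem secondKey_strictly_separates_origin {p : ℕ} [CharP k p] [PerfectField k] {Λ : Ordinal.{0}}
    (ι₂ : (R : Type) → [CommRing R] → R → Ordinal.{0}) (J : (R : Type) → [CommRing R] → R → ℕ → Ideal R)
    (hb : IotaBoundedBy Λ ι₂) (hc6 : IotaIsoInvariant (iotaLex Λ iotaOrd ι₂))
    (hc7 : IotaGenerizationMonotone (iotaLex Λ iotaOrd ι₂)) (hgame : CanonicalGameClause p (iotaLex Λ iotaOrd ι₂) J) :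
    ι₂ (Localization.AtPrime (QS₁ k)) (algebraMap (OriginLocalization k 3) (Localization.AtPrime (QS₁ k)) (fS k)) <
        ι₂ (OriginLocalization k 3) (fS k) ∧
      ι₂ (Localization.AtPrime (QS₂ k)) (algebraMap (OriginLocalization k 3) (Localization.AtPrime (QS₂ k)) (fS k)) <
        ι₂ (OriginLocalization k 3) (fS k) := by
  obtain ⟨h₁, h₂⟩ := witness_strictly_separates_origin k _ J hc6 hc7 hgame
  rw [iotaLex_lt_iff hb, iotaOrd_QS₁] at h₁
  rw [iotaLex_lt_iff hb, iotaOrd_QS₂] at h₂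
  exact ⟨(h₁.resolve_left (lt_irrefl _)).2, (h₂.resolve_left (lt_irrefl _)).2⟩

end StratSpecimen

end Summit.ResolutionOfSingularities.ResolutionOfSingularities.Cruxes.HypersurfaceCentreConstruction.LocalEngine

end
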